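import Literature.Computability.QuantumComplexity.GuessedAnnRuns
import Literature.Computability.QuantumComplexity.AaronsonAmbainisThm23Atoms
import Literature.Computability.Complexity.GapNatPSpace
import Literature.Computability.Complexity.CodeFPArith
import Literature.Computability.Complexity.CHCounting
import HarnessLib

/-!
# Pair counts of per-gate-annotated prefixes of a uniform Clifford+`T` family are `GapNatPSPACE` functions

Toolkit file (`Literature/Computability/QuantumComplexity`), the polynomial-SPACE counterpart of the
single-oracle counting machines of `AccGapMachine.lean` (`accGap ∈ GapP^A`) and of the Aaronson–Ambainis
atoms of `AaronsonAmbainisThm23Atoms.lean`, for annotated gate lists whose oracle gates carry THEIR OWN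
languages (`GuessedAnnRuns.lean`: `ADH.annotate As gs`, gate `t` answered by `As t`). This is the shape
of the replaced circuits of Aaronson–Chen 2017, Lemma 5.3 (CCC 2017, §5.3, pp. 22–23: the `t`-th
`O`-gate of a `SampBQP^{TQBF,O}` circuit replaced by the gate of `TQBF ⊕ (O ∩ K_t)`), whose classical
`SampBPP^{TQBF,O}` simulator must decide EXACTLY the `√2`-threshold tests `linFormTest` of
`OraclePathSums.lean` on the integer pair counts `A_S = annSetA`, `B_S = annSetB` of a prefix of the
replaced circuit ("all the computations can be done in `PSPACE`, and therefore can be implemented in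
`poly(n, 1/ε)` time with the help of the `TQBF` oracle", p. 23). By `LinFormTestPSpace.lean` those tests
are `PSPACE` predicates as soon as the pair counts are `GapNatPSPACE` functions (`Complexity/GapNatPSpace.lean`:
Ladner's `♮PSPACE` in witness form and its gap closure, closed under uniform exponential sums). This file
proves exactly that, for pair counts read off an arbitrary instance string:

* `ADH.PCSpec` — the data: a Clifford+`T` query family `F`, and readers of the instance `z`: the circuit
  input `xf z`, the prefix length `nf z`, the annotation languages `As z u` and the label test `Sb z ℓ`
  (on the bit string `ℓ = ofFn x` of a basis label); `D.gas z = annotate (As z) ((gates (xf z)).take (nf z))`,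
  `D.S z = {x | Sb z (ofFn x)}`, and **`D.pcA z = annSetA (D.gas z) (w₀ F (xf z)) (D.S z)`**, `D.pcB` likewise;
* `ADH.PCSpec.IsGood` — the hypotheses: `F` uniform, `xf ∈ FP`, `nf` polynomial-time (binary), membership
  `s ∈ As z ⟦y⟧` a `PSPACE` predicate of `⟨z, ⟨y, s⟩⟩`, and `Sb` polynomial-time on `⟨z, ℓ⟩`;
* **`ADH.PCSpec.pcA_mem_GapNatPSPACE`**, **`ADH.PCSpec.pcB_mem_GapNatPSPACE`** — under `IsGood`, both pair
  counts are `GapNatPSPACE` functions of the instance.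

**The proof** (Bernstein–Vazirani / Adleman–DeMarrais–Huang counting with GUESSED oracle answers, the
guesses verified in polynomial space). By `ADH.annSetA_eq_sum_consG` (`GuessedAnnRuns.lean`) the pair count
is the sum, over PAIRS of coin strings `c, c'` of the guessed total walk `ADH.tRunO` (one coin per gate; at an
oracle gate the coin is the guessed answer bit) that are CONSISTENT (`ADH.ConsG`: every guess is the answer
of the gate's own language on the query read off the walk so far), of the pair term `pairTermA ∈ {0, ±1}` of
the two final states. Hence `A_S(z) = Σ_{w ∈ {0,1}^{2m}} G_A(⟨z, w⟩)` (`pcA_eq_sumA`) with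
`G_A = [R₀] − [R₄]`, `R_d` = "both halves of `w` consistent, both walks valid, same final label, the label
passes `Sb`, phase class `(φ + 7φ') mod 8 = d`" (`GA_pair`, through the bijection
`{0,1}^{2m} ≃ ({0,1}^m)²`, `sum_vector_eq_sum_pair`). Consistency is a polynomially bounded `∀` over the
gate index (`consG_iff_forall`) of a condition on the polynomial-time ATOMS of
`AaronsonAmbainisThm23Atoms.lean` on the counted walk `ADH.walkO` (`orcT`: gate `t` is an oracle gate;
`coinT`: the coin; `qryF`: the query at the label before round `t`) and ONE membership query to `As z t`
(`CAtProp`, `cAtProp_iff_of_oracle`, `mem_CAll_iff_consG`), so `R_d ∈ PSPACE` (`polyForall_mem_PSPACE`,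
Boolean closure through a complete set, `R_mem_PSPACE`); the final-state test reads the label, unary phase
and validity fields of `walkO` after `nf z` rounds (`walkO_fields`, `finB_pair`, `finB_code`). Then
`sum_mem_GapNatPSPACE` and `ite_mem_GapNatPSPACE` (Fenner–Fortnow–Kurtz §3, relativized to polynomial-space
verifiers) give the result.

## Design notes

* Everything machine-level is assembled in the typed `CodeFP` layer (`Complexity/CodeFP.lean`) from
  bricks already in the tree; compositions whose arguments are machine terms are instantiated from
  GENERIC lemmas (`rho_code`, `pair2_code`, `pair3_code`, `eqStr_code`, …) whose `congr`-step is on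
  abstract functions — matching a composed code against a stated map containing machine terms makes the
  unifier unfold the machines (heartbeat explosion).
* The witness is summed over `{0,1}^{2m}` with `m = |gas z| = min (nf z) μ` exactly (`tf z = 1^{2m}`), so no
  padding constraints are needed; `tRunO` and `ConsG` read only the first `m` coins of each half.
* No named facts; all theorems proved. First client: the `PSPACE` membership of the two physical
  predicates `HeavyLang`/`CdfLang` of the advice language of Aaronson–Chen's simulator
  (`Literature/Barriers/QuantumAdvantage/AaronsonChenAdvicePhysics.lean`).

## References

* S. Aaronson, L. Chen, *Complexity-theoretic foundations of quantum supremacy experiments*, CCC 2017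
  (LIPIcs 79, 22; doi:10.4230/LIPIcs.CCC.2017.22; arXiv:1612.05903), Lemma 5.3 and §5.3 (pp. 22–23, "all the
  computations can be done in PSPACE"), read via `lit read arxiv:1612.05903 --pages 21-23` [AaronsonChen2017].
* L. M. Adleman, J. DeMarrais, M.-D. A. Huang, *Quantum computability*, SIAM J. Comput. 26 (1997), §6,
  Lemma 6.10 (pairs of paths, phase classes) [AdlemanDeMarraisHuang1997].
* S. Fenner, L. Fortnow, S. Kurtz, *Gap-definable counting classes*, JCSS 48 (1994), §3 (closure of gap
  classes under uniform sums; relativizing) [FennerFortnowKurtz1994], as `Complexity/GapNatPSpace.lean`.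
* S. Aaronson, A. Ambainis, Theory Comput. 10 (2014), proof of Thm. 23 (counting guessed paths)
  [AaronsonAmbainis2014], as `AaronsonAmbainisThm23Atoms.lean`.
* S. Arora, B. Barak, *Computational Complexity: A Modern Approach*, CUP 2009, §1.3, §6.2 (polynomial time,
  uniform families), Thm. 4.2 and §4.1 (`PSPACE` closure) [AroraBarak2009] [AroraBarakCC2009].
-/

noncomputable section

namespace Literature.Computability.QuantumComplexity

namespace ADH

open _root_.Computability Polynomial Complexity Complexity.Brick Complexity.Plumb Cryptography
open Complexity.PRelSigma Complexity.CodeFP Complexity.TTClosure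

/-! ### The state of the guessed walk after a prefix, read off the counted walk record -/

section PrefixAtoms

variable (F : QCircuitFamily cliffordT)

/-- The guessed state after the first `t` gates (all of them when `t ≥ μ`), from `|x, 0^m⟩`, phase `0`,
valid. [folklore] -/
abbrev stAt (x c : List Bool) (t : ℕ) : TState (x.length + F.ancillas x.length) :=
  tRunO (((F.circ x.length).gates).take t) c (w₀ F x, 0, true)

/-- **The counted walk record after `t` rounds holds the state after the first `t` gates** (label
bits, unary phase, validity bit), for every `t`. [folklore] -/
theorem walkO_fields (x c : List Bool) (t : ℕ) :
    wF (walkO F (boolPair x (boolPair c (encodeNat t)))) = List.ofFn (stAt F x c t).1 ∧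
    phF (walkO F (boolPair x (boolPair c (encodeNat t)))) = ones (stAt F x c t).2.1 ∧
    vT (walkO F (boolPair x (boolPair c (encodeNat t)))) = [(stAt F x c t).2.2] := by
  rcases le_total t (F.circ x.length).gates.length with ht | ht
  · rw [walkO_apply F x c ht]
    refine ⟨by simp [rec6, nthF], by simp [rec6, nthF], ?_⟩
    rw [vT_apply]
    simp only [rec6, sndPow, Function.comp_apply, sndF_boolPair]
    cases (stAt F x c t).2.2 <;> simp
  · rw [walkO_apply_of_le F x c ht]
    have htake : ((F.circ x.length).gates).take t = (F.circ x.length).gates := List.take_of_length_le ht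
    refine ⟨by simp [rec6, nthF, stAt, htake], by simp [rec6, nthF, stAt, htake], ?_⟩
    rw [vT_apply]
    simp only [rec6, sndPow, Function.comp_apply, sndF_boolPair]
    cases h : (tRunO (F.circ x.length).gates c (w₀ F x, 0, true)).2.2 <;> simp [stAt, htake, h]

end PrefixAtoms

/-! ### The data: a uniform family, and instance readers -/

/-- **The data of a family of annotated prefixes read off an instance string `z`**: a Clifford+`T`
query family `F`, the circuit input `xf z`, the prefix length `nf z`, the per-gate annotation
languages `As z u` and the label test `Sb z ℓ` (on the bit string `ℓ` of a basis label). [folklore] -/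
structure PCSpec where
  /-- the circuit family -/
  F : QCircuitFamily cliffordT
  /-- the circuit input, read off the instance -/
  xf : List Bool → List Bool
  /-- the prefix length, read off the instance -/
  nf : List Bool → ℕ
  /-- the language annotating gate `u`, for the instance -/
  As : List Bool → ℕ → Language Bool
  /-- the label test defining the label set, for the instance -/
  Sb : List Bool → List Bool → Bool

namespace PCSpec

variable (D : PCSpec)

/-- The number of wires of the circuit of the instance. [folklore] -/
abbrev N (z : List Bool) : ℕ := (D.xf z).length + D.F.ancillas (D.xf z).length

/-- The gate list of the circuit of the instance. [folklore] -/
abbrev gates (z : List Bool) : List (QGate cliffordT (D.N z)) := (D.F.circ (D.xf z).length).gates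

/-- The number of gates `μ`. [folklore] -/
def μ (z : List Bool) : ℕ := (D.gates z).length

/-- The length of the annotated prefix, `min n μ`. [folklore] -/
def m (z : List Bool) : ℕ := min (D.nf z) (D.μ z)

/-- **The annotated prefix of the instance**: the first `nf z` gates, gate `u` annotated by `As z u`.
[cite: AaronsonChen2017, §5.3 (p. 22, the t-th O-gate replaced by g_t)] -/
def gas (z : List Bool) : List (AnnGate (D.N z)) := annotate (D.As z) ((D.gates z).take (D.nf z))

/-- The label set of the instance. [folklore] -/
def S (z : List Bool) : Set (QReg (D.N z)) := {ℓ | D.Sb z (List.ofFn ℓ) = true}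

/-- **The first pair count** `A_S` of the annotated prefix from `|x, 0^m⟩`. [cite: AdlemanDeMarraisHuang1997, §6 Lemma 6.10] -/
def pcA (z : List Bool) : ℤ := annSetA (D.gas z) (w₀ D.F (D.xf z)) (D.S z)

/-- **The second pair count** `B_S` of the annotated prefix from `|x, 0^m⟩`. [cite: AdlemanDeMarraisHuang1997, §6 Lemma 6.10] -/
def pcB (z : List Bool) : ℤ := annSetB (D.gas z) (w₀ D.F (D.xf z)) (D.S z)

/-- The length of the annotated prefix is `m`. [folklore] -/
theorem length_gas (z : List Bool) : (D.gas z).length = D.m z := by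
  simp [gas, m, μ, List.length_take]

/-- Forgetting the annotations gives back the prefix. [folklore] -/
theorem gas_map_fst (z : List Bool) : (D.gas z).map Prod.fst = (D.gates z).take (D.nf z) :=
  map_fst_annotate _ _

/-! ### The string-level relations -/

/-- The walk record argument `⟨x, ⟨cs, bin t⟩⟩` of the atoms. [folklore] -/
def rho (z cs : List Bool) (t : ℕ) : List Bool := boolPair (D.xf z) (boolPair cs (encodeNat t))

/-- The consistency condition of the guessed coin `t`: if gate `t` is an oracle gate, the coin is the
answer of `As z t` on the query read off the walk of the first `t` gates. [cite: AaronsonChen2017, §5.3 (p. 23)] -/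
def CAtProp (z cs : List Bool) (t : ℕ) : Prop :=
  orcT D.F (D.rho z cs t) = [true] → (coinT D.F (D.rho z cs t) = [true] ↔ qryF D.F (D.rho z cs t) ∈ D.As z t)

/-- The consistency condition as a language of strings `⟨z, ⟨cs, y⟩⟩`, `t = ⟦y⟧`. [folklore] -/
def CAt : Language Bool :=
  {θ | D.CAtProp (fstP θ) (fstP (sndP θ)) (bitsToNat (sndP (sndP θ)))}

/-- The body of the bounded quantifier: on `⟨⟨z, cs⟩, y⟩`, if `⟦y⟧ < nf z` and `⟦y⟧ < |cs|` then
`⟨z, ⟨cs, y⟩⟩ ∈ CAt`. [folklore] -/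
def CAllBody : Language Bool :=
  {q | bitsToNat (sndP q) < D.nf (fstP (fstP q)) → bitsToNat (sndP q) < (sndP (fstP q)).length →
    boolPair (fstP (fstP q)) (boolPair (sndP (fstP q)) (sndP q)) ∈ D.CAt}

/-- **All guesses consistent**, as a language of strings `⟨z, cs⟩` (a polynomially bounded `∀`).
[cite: AaronsonChen2017, §5.3 (p. 23, "all the computations can be done in PSPACE")] -/
def CAll : Language Bool :=
  {v | ∀ y : List Bool, y.length ≤ (X : Polynomial ℕ).eval v.length → boolPair v y ∈ D.CAllBody}

/-- The first coin string of a counted pair `⟨z, w⟩`: `w ↾ m`. [folklore] -/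
def c₁ (q : List Bool) : List Bool := (sndP q).take (D.m (fstP q))

/-- The second coin string of a counted pair `⟨z, w⟩`: `w ⇂ m`. [folklore] -/
def c₂ (q : List Bool) : List Bool := (sndP q).drop (D.m (fstP q))

/-- The walk record argument of the first walk, `nf z` rounds. [folklore] -/
def ρ₁ (q : List Bool) : List Bool := D.rho (fstP q) (D.c₁ q) (D.nf (fstP q))

/-- The walk record argument of the second walk, `nf z` rounds. [folklore] -/
def ρ₂ (q : List Bool) : List Bool := D.rho (fstP q) (D.c₂ q) (D.nf (fstP q))

/-- **The final-state test of class `d`**: both walks valid, same final label, the label passes the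
test, and the phase-difference class `(φ + 7φ') mod 8` is `d`. [cite: AdlemanDeMarraisHuang1997, §6 Lemma 6.10 (phase classes of path pairs)] -/
def finB (d : ℕ) (q : List Bool) : Bool :=
  decide (vT (walkO D.F (D.ρ₁ q)) = [true]) && (decide (vT (walkO D.F (D.ρ₂ q)) = [true]) &&
    (decide (wF (walkO D.F (D.ρ₁ q)) = wF (walkO D.F (D.ρ₂ q))) && (D.Sb (fstP q) (wF (walkO D.F (D.ρ₁ q))) &&
      decide (((phF (walkO D.F (D.ρ₁ q))).length + 7 * (phF (walkO D.F (D.ρ₂ q))).length) % 8 = d))))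

/-- **The counted relation of class `d`**: both coin strings consistent and the final-state test.
[cite: AaronsonChen2017, §5.3 (p. 23)] -/
def R (d : ℕ) : Language Bool :=
  {q | boolPair (fstP q) (D.c₁ q) ∈ D.CAll ∧ boolPair (fstP q) (D.c₂ q) ∈ D.CAll ∧ D.finB d q = true}

open scoped Classical in
/-- The signed summand of `A_S`: `[class 0] − [class 4]`. [cite: AdlemanDeMarraisHuang1997, §6 Lemma 6.10] -/
def GA (q : List Bool) : ℤ := (if q ∈ D.R 0 then 1 else 0) - (if q ∈ D.R 4 then 1 else 0)

open scoped Classical in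
/-- The signed summand of `B_S`: `[class 1] + [class 7] − [class 3] − [class 5]`. [cite: AdlemanDeMarraisHuang1997, §6 Lemma 6.10] -/
def GB (q : List Bool) : ℤ :=
  (if q ∈ D.R 1 then 1 else 0) + (if q ∈ D.R 7 then 1 else 0) - (if q ∈ D.R 3 then 1 else 0) -
    (if q ∈ D.R 5 then 1 else 0)

/-- The witness length `1^{2m}`. [folklore] -/
def tf (z : List Bool) : List Bool := ones (2 * D.m z)

/-- The first pair count as a uniform exponential sum of `GA`. [folklore] -/
def sumA (z : List Bool) : ℤ := ∑ w : List.Vector Bool (D.tf z).length, D.GA (boolPair z w.toList)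

/-- The second pair count as a uniform exponential sum of `GB`. [folklore] -/
def sumB (z : List Bool) : ℤ := ∑ w : List.Vector Bool (D.tf z).length, D.GB (boolPair z w.toList)

/-! ### Semantics of the consistency language -/

/-- Membership in `CAt` (definitional). [folklore] -/
theorem mem_CAt_iff (θ : List Bool) :
    θ ∈ D.CAt ↔ D.CAtProp (fstP θ) (fstP (sndP θ)) (bitsToNat (sndP (sndP θ))) := Iff.rfl

/-- Membership in `CAllBody` (definitional). [folklore] -/
theorem mem_CAllBody_iff (q : List Bool) :
    q ∈ D.CAllBody ↔ (bitsToNat (sndP q) < D.nf (fstP (fstP q)) → bitsToNat (sndP q) < (sndP (fstP q)).length →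
      boolPair (fstP (fstP q)) (boolPair (sndP (fstP q)) (sndP q)) ∈ D.CAt) := Iff.rfl

/-- Membership in `CAll` (definitional). [folklore] -/
theorem mem_CAll_iff' (v : List Bool) :
    v ∈ D.CAll ↔ ∀ y : List Bool, y.length ≤ (X : Polynomial ℕ).eval v.length → boolPair v y ∈ D.CAllBody := Iff.rfl

/-- Membership in `R d` (definitional). [folklore] -/
theorem mem_R_iff (d : ℕ) (q : List Bool) :
    q ∈ D.R d ↔ boolPair (fstP q) (D.c₁ q) ∈ D.CAll ∧ boolPair (fstP q) (D.c₂ q) ∈ D.CAll ∧ D.finB d q = true := Iff.rfl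

/-- An oracle-gate entry of the annotated prefix. [folklore] -/
theorem gas_getElem?_eq_some_iff (z : List Bool) (t k : ℕ) (e : Fin (k + 1) ↪ Fin (D.N z)) (A : Language Bool) :
    (D.gas z)[t]? = some (QGate.oracle k e, A) ↔ t < D.nf z ∧ (D.gates z)[t]? = some (.oracle k e) ∧ A = D.As z t := by
  rw [gas, getElem?_annotate, List.getElem?_take]
  split_ifs with h
  · cases (D.gates z)[t]? with
    | none => simp [h]
    | some g => simp only [Option.map_some, Option.some.injEq, Prod.mk.injEq, h, true_and]; tauto
  · simp [h]

/-- The test "gate `t` is an oracle gate" from its optional value. [folklore] -/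
theorem map_isOracleB_getD_eq_true_iff {N : ℕ} (g : Option (QGate cliffordT N)) :
    (g.map isOracleB).getD false = true ↔ ∃ (k : ℕ) (e : Fin (k + 1) ↪ Fin N), g = some (.oracle k e) := by
  rcases g with _ | ⟨op, e⟩ | ⟨k, e⟩
  · simp
  · simp [isOracleB]
  · simp only [Option.map_some, Option.getD_some, isOracleB, true_iff]
    exact ⟨k, e, rfl⟩

/-- A Boolean is the indicator bit of a membership iff it tests it. [folklore] -/
theorem eq_true_iff_mem_iff_eq_boolIndicator {α : Type*} (A : Set α) (a : α) (b : Bool) :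
    (b = true ↔ a ∈ A) ↔ b = A.boolIndicator a := by
  by_cases h : a ∈ A
  · rw [(Set.mem_iff_boolIndicator _ _).1 h]
    exact ⟨fun h' => h'.2 h, fun h' => ⟨fun _ => h, fun _ => h'⟩⟩
  · rw [(Set.notMem_iff_boolIndicator _ _).1 h]
    constructor
    · intro h'
      cases b
      · rfl
      · exact absurd (h'.1 rfl) h
    · rintro rfl
      simp [h]

/-- **The consistency condition at an oracle gate `t`** is the equation of `ConsG`: the coin is the
indicator of the gate's language on the query. [cite: AaronsonChen2017, §5.3 (p. 23)] -/
theorem cAtProp_iff_of_oracle (z cs : List Bool) {t k : ℕ} {e : Fin (k + 1) ↪ Fin (D.N z)}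
    (hg : (D.gates z)[t]? = some (.oracle k e)) :
    D.CAtProp z cs t ↔ cs.getD t false = (D.As z t).boolIndicator (queryOf e (labAt D.F (D.xf z) cs t)) := by
  have ht : t < (D.F.circ (D.xf z).length).gates.length := by
    by_contra h
    rw [List.getElem?_eq_none (not_lt.1 h)] at hg
    exact absurd hg (by simp)
  have hg' : (D.F.circ (D.xf z).length).gates[t] = .oracle k e := by
    have := List.getElem?_eq_getElem ht ▸ hg
    exact Option.some.inj this
  unfold CAtProp rho
  rw [orcT_apply, coinT_apply D.F (D.xf z) cs ht, qryF_apply D.F (D.xf z) cs ht hg']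
  have horc : [(((D.F.circ (D.xf z).length).gates[t]?).map isOracleB).getD false] = [true] := by
    rw [show (D.F.circ (D.xf z).length).gates[t]? = some (.oracle k e) from hg]; rfl
  simp only [horc, true_implies, List.cons.injEq, and_true]
  exact eq_true_iff_mem_iff_eq_boolIndicator _ _ _

/-- The consistency condition holds trivially where gate `t` is not an oracle gate. [folklore] -/
theorem cAtProp_of_not_oracle (z cs : List Bool) {t : ℕ}
    (hg : ∀ (k : ℕ) (e : Fin (k + 1) ↪ Fin (D.N z)), (D.gates z)[t]? ≠ some (.oracle k e)) : D.CAtProp z cs t := by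
  intro horc
  exfalso
  unfold rho at horc
  rw [orcT_apply] at horc
  obtain ⟨k, e, hke⟩ := (map_isOracleB_getD_eq_true_iff _).1 (List.cons.inj horc).1
  exact hg k e hke

/-- **Membership in `CAll`**: all the consistency conditions below `nf z` and `|cs|`. [folklore] -/
theorem mem_CAll_iff (z cs : List Bool) :
    boolPair z cs ∈ D.CAll ↔ ∀ t, t < D.nf z → t < cs.length → D.CAtProp z cs t := by
  rw [mem_CAll_iff']
  constructor
  · intro h t ht htc
    have hy := h (encodeNat t) (by
      rw [eval_X, length_boolPair]
      have := length_natE_le t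
      change (encodeNat t).length ≤ t at this
      omega)
    rw [mem_CAllBody_iff] at hy
    simp only [fstP_boolPair, sndP_boolPair, bitsToNat_encodeNat] at hy
    have hy' := hy ht htc
    rw [mem_CAt_iff] at hy'
    simpa only [fstP_boolPair, sndP_boolPair, bitsToNat_encodeNat] using hy'
  · intro h y _
    rw [mem_CAllBody_iff]
    simp only [fstP_boolPair, sndP_boolPair]
    intro ht htc
    rw [mem_CAt_iff]
    simpa only [fstP_boolPair, sndP_boolPair] using h _ ht htc

/-- **`CAll` is consistency of the guesses with the gates' own languages** (`ConsG` of the annotated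
prefix), for coin strings at least as long as the prefix. [cite: AaronsonChen2017, §5.3 (p. 23)] -/
theorem mem_CAll_iff_consG (z cs : List Bool) (hlen : D.m z ≤ cs.length) :
    boolPair z cs ∈ D.CAll ↔ ConsG (D.gas z) cs (w₀ D.F (D.xf z)) := by
  rw [mem_CAll_iff, consG_iff_forall]
  have hfst : (D.gas z).map Prod.fst = (D.gates z).take (D.nf z) := D.gas_map_fst z
  constructor
  · intro h t k e A hA
    obtain ⟨htn, hg, rfl⟩ := (D.gas_getElem?_eq_some_iff z t k e A).1 hA
    have htμ : t < D.μ z := by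
      by_contra hc
      rw [μ, not_lt] at hc
      rw [List.getElem?_eq_none hc] at hg
      exact absurd hg (by simp)
    have htm : t < D.m z := lt_min htn htμ
    have h1 := (D.cAtProp_iff_of_oracle z cs hg).1 (h t htn (lt_of_lt_of_le htm hlen))
    rw [h1, hfst, List.take_take, min_eq_left htn.le]
  · intro h t htn _
    by_cases hex : ∃ (k : ℕ) (e : Fin (k + 1) ↪ Fin (D.N z)), (D.gates z)[t]? = some (.oracle k e)
    · obtain ⟨k, e, hg⟩ := hex
      rw [D.cAtProp_iff_of_oracle z cs hg]
      have := h t k e (D.As z t) ((D.gas_getElem?_eq_some_iff z t k e _).2 ⟨htn, hg, rfl⟩)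
      rw [this, hfst, List.take_take, min_eq_left htn.le]
    · exact D.cAtProp_of_not_oracle z cs fun k e hke => hex ⟨k, e, hke⟩

/-! ### Semantics of the final-state test and of the summands -/

/-- The final state of the prefix walk on the coins `cs`. [folklore] -/
abbrev st (z cs : List Bool) : TState (D.N z) := stAt D.F (D.xf z) cs (D.nf z)

section Pair

variable (z : List Bool) (c c' : Fin (D.gas z).length → Bool)

/-- The first coin string of the counted pair `⟨z, c c'⟩`. [folklore] -/
theorem c₁_pair : D.c₁ (boolPair z (List.ofFn c ++ List.ofFn c')) = List.ofFn c := by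
  rw [c₁, fstP_boolPair, sndP_boolPair, ← D.length_gas z]
  exact List.take_left' (List.length_ofFn)

/-- The second coin string of the counted pair `⟨z, c c'⟩`. [folklore] -/
theorem c₂_pair : D.c₂ (boolPair z (List.ofFn c ++ List.ofFn c')) = List.ofFn c' := by
  rw [c₂, fstP_boolPair, sndP_boolPair, ← D.length_gas z]
  exact List.drop_left' (List.length_ofFn)

/-- **The final-state test on a counted pair** reads the two final states. [cite: AdlemanDeMarraisHuang1997, §6 Lemma 6.10] -/
theorem finB_pair (d : ℕ) :
    D.finB d (boolPair z (List.ofFn c ++ List.ofFn c')) = true ↔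
      (D.st z (List.ofFn c)).2.2 = true ∧ (D.st z (List.ofFn c')).2.2 = true ∧
        (D.st z (List.ofFn c)).1 = (D.st z (List.ofFn c')).1 ∧ (D.st z (List.ofFn c)).1 ∈ D.S z ∧
          ((D.st z (List.ofFn c)).2.1 + 7 * (D.st z (List.ofFn c')).2.1) % 8 = d := by
  obtain ⟨h1, h2, h3⟩ := walkO_fields D.F (D.xf z) (List.ofFn c) (D.nf z)
  obtain ⟨h1', h2', h3'⟩ := walkO_fields D.F (D.xf z) (List.ofFn c') (D.nf z)
  unfold finB ρ₁ ρ₂ rho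
  rw [c₁_pair, c₂_pair, fstP_boolPair, h1, h2, h3, h1', h2', h3']
  simp only [Bool.and_eq_true, decide_eq_true_eq, List.cons.injEq, and_true, List.ofFn_inj, length_ones, S,
    Set.mem_setOf_eq]

open scoped Classical in
/-- **The signed summand of `A_S` on a counted pair** is the consistent pair term of the two guessed
walks. [cite: AdlemanDeMarraisHuang1997, §6 Lemma 6.10] [cite: AaronsonChen2017, §5.3 (p. 23)] -/
theorem GA_pair :
    D.GA (boolPair z (List.ofFn c ++ List.ofFn c')) =
      if ConsG (D.gas z) (List.ofFn c) (w₀ D.F (D.xf z)) ∧ ConsG (D.gas z) (List.ofFn c') (w₀ D.F (D.xf z)) then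
        pairTermA (D.S z) (tRunO ((D.gas z).map Prod.fst) (List.ofFn c) (w₀ D.F (D.xf z), 0, true))
          (tRunO ((D.gas z).map Prod.fst) (List.ofFn c') (w₀ D.F (D.xf z), 0, true))
      else 0 := by
  have hlen : D.m z ≤ (List.ofFn c).length := by rw [List.length_ofFn, D.length_gas z]
  have hlen' : D.m z ≤ (List.ofFn c').length := by rw [List.length_ofFn, D.length_gas z]
  unfold GA
  rw [mem_R_iff, mem_R_iff, fstP_boolPair, c₁_pair, c₂_pair, D.mem_CAll_iff_consG z _ hlen,
    D.mem_CAll_iff_consG z _ hlen', finB_pair, finB_pair, gas_map_fst]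
  by_cases hC : ConsG (D.gas z) (List.ofFn c) (w₀ D.F (D.xf z)) ∧ ConsG (D.gas z) (List.ofFn c') (w₀ D.F (D.xf z))
  · simp only [hC, true_and, if_true]
    unfold pairTermA
    by_cases hcond : (D.st z (List.ofFn c)).2.2 = true ∧ (D.st z (List.ofFn c')).2.2 = true ∧
        (D.st z (List.ofFn c)).1 = (D.st z (List.ofFn c')).1 ∧ (D.st z (List.ofFn c)).1 ∈ D.S z
    · obtain ⟨q1, q2, q3, q4⟩ := hcond
      have q4' : (D.st z (List.ofFn c')).1 ∈ D.S z := q3 ▸ q4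
      simp only [st, stAt] at q1 q2 q3 q4'
      have hlt : ((tRunO (List.take (D.nf z) (D.gates z)) (List.ofFn c) (w₀ D.F (D.xf z), 0, true)).2.1 +
          7 * (tRunO (List.take (D.nf z) (D.gates z)) (List.ofFn c') (w₀ D.F (D.xf z), 0, true)).2.1) % 8 < 8 :=
        Nat.mod_lt _ (by norm_num)
      simp only [st, stAt, q1, q2, q3, q4', true_and, and_true, if_true]
      generalize ((tRunO (List.take (D.nf z) (D.gates z)) (List.ofFn c) (w₀ D.F (D.xf z), 0, true)).2.1 +
        7 * (tRunO (List.take (D.nf z) (D.gates z)) (List.ofFn c') (w₀ D.F (D.xf z), 0, true)).2.1) % 8 = cls at hlt ⊢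
      interval_cases cls <;> simp [reA]
    · rw [if_neg hcond, if_neg (fun h => hcond ⟨h.1, h.2.1, h.2.2.1, h.2.2.2.1⟩),
        if_neg (fun h => hcond ⟨h.1, h.2.1, h.2.2.1, h.2.2.2.1⟩)]
      simp
  · rw [if_neg hC, if_neg (fun h => hC ⟨h.1, h.2.1⟩), if_neg (fun h => hC ⟨h.1, h.2.1⟩)]
    simp

open scoped Classical in
/-- **The signed summand of `B_S` on a counted pair.** [cite: AdlemanDeMarraisHuang1997, §6 Lemma 6.10] [cite: AaronsonChen2017, §5.3 (p. 23)] -/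
theorem GB_pair :
    D.GB (boolPair z (List.ofFn c ++ List.ofFn c')) =
      if ConsG (D.gas z) (List.ofFn c) (w₀ D.F (D.xf z)) ∧ ConsG (D.gas z) (List.ofFn c') (w₀ D.F (D.xf z)) then
        pairTermB (D.S z) (tRunO ((D.gas z).map Prod.fst) (List.ofFn c) (w₀ D.F (D.xf z), 0, true))
          (tRunO ((D.gas z).map Prod.fst) (List.ofFn c') (w₀ D.F (D.xf z), 0, true))
      else 0 := by
  have hlen : D.m z ≤ (List.ofFn c).length := by rw [List.length_ofFn, D.length_gas z]
  have hlen' : D.m z ≤ (List.ofFn c').length := by rw [List.length_ofFn, D.length_gas z]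
  unfold GB
  rw [mem_R_iff, mem_R_iff, mem_R_iff, mem_R_iff, fstP_boolPair, c₁_pair, c₂_pair, D.mem_CAll_iff_consG z _ hlen,
    D.mem_CAll_iff_consG z _ hlen', finB_pair, finB_pair, finB_pair, finB_pair, gas_map_fst]
  by_cases hC : ConsG (D.gas z) (List.ofFn c) (w₀ D.F (D.xf z)) ∧ ConsG (D.gas z) (List.ofFn c') (w₀ D.F (D.xf z))
  · simp only [hC, true_and, if_true]
    unfold pairTermB
    by_cases hcond : (D.st z (List.ofFn c)).2.2 = true ∧ (D.st z (List.ofFn c')).2.2 = true ∧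
        (D.st z (List.ofFn c)).1 = (D.st z (List.ofFn c')).1 ∧ (D.st z (List.ofFn c)).1 ∈ D.S z
    · obtain ⟨q1, q2, q3, q4⟩ := hcond
      have q4' : (D.st z (List.ofFn c')).1 ∈ D.S z := q3 ▸ q4
      simp only [st, stAt] at q1 q2 q3 q4'
      have hlt : ((tRunO (List.take (D.nf z) (D.gates z)) (List.ofFn c) (w₀ D.F (D.xf z), 0, true)).2.1 +
          7 * (tRunO (List.take (D.nf z) (D.gates z)) (List.ofFn c') (w₀ D.F (D.xf z), 0, true)).2.1) % 8 < 8 :=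
        Nat.mod_lt _ (by norm_num)
      simp only [st, stAt, q1, q2, q3, q4', true_and, and_true, if_true]
      generalize ((tRunO (List.take (D.nf z) (D.gates z)) (List.ofFn c) (w₀ D.F (D.xf z), 0, true)).2.1 +
        7 * (tRunO (List.take (D.nf z) (D.gates z)) (List.ofFn c') (w₀ D.F (D.xf z), 0, true)).2.1) % 8 = cls at hlt ⊢
      interval_cases cls <;> simp [reB]
    · rw [if_neg hcond, if_neg (fun h => hcond ⟨h.1, h.2.1, h.2.2.1, h.2.2.2.1⟩),
        if_neg (fun h => hcond ⟨h.1, h.2.1, h.2.2.1, h.2.2.2.1⟩), if_neg (fun h => hcond ⟨h.1, h.2.1, h.2.2.1, h.2.2.2.1⟩),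
        if_neg (fun h => hcond ⟨h.1, h.2.1, h.2.2.1, h.2.2.2.1⟩)]
      simp
  · rw [if_neg hC, if_neg (fun h => hC ⟨h.1, h.2.1⟩), if_neg (fun h => hC ⟨h.1, h.2.1⟩), if_neg (fun h => hC ⟨h.1, h.2.1⟩),
      if_neg (fun h => hC ⟨h.1, h.2.1⟩)]
    simp

end Pair

/-! ### The pair counts are the uniform exponential sums -/

/-- Transport of a sum over bit vectors along an equality of lengths. [folklore] -/
theorem sum_vector_congr {M : Type*} [AddCommMonoid M] {a b : ℕ} (h : a = b) (f : List Bool → M) :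
    ∑ w : List.Vector Bool a, f w.toList = ∑ w : List.Vector Bool b, f w.toList := by
  subst h; rfl

/-- **Bit vectors of length `2k` are the pairs of coin functions on `Fin k`** (as `ofFn c ++ ofFn c'`).
[folklore] -/
theorem sum_vector_eq_sum_pair {M : Type*} [AddCommMonoid M] (k : ℕ) (f : List Bool → M) :
    ∑ w : List.Vector Bool (2 * k), f w.toList =
      ∑ c : Fin k → Bool, ∑ c' : Fin k → Bool, f (List.ofFn c ++ List.ofFn c') := by
  rw [← Fintype.sum_prod_type']
  let φ : (Fin k → Bool) × (Fin k → Bool) → List.Vector Bool (2 * k) :=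
    fun p => ⟨List.ofFn p.1 ++ List.ofFn p.2, by simp [two_mul]⟩
  have hφ : Function.Bijective φ := by
    rw [Fintype.bijective_iff_injective_and_card]
    refine ⟨fun p q h => ?_, ?_⟩
    · have h' : List.ofFn p.1 ++ List.ofFn p.2 = List.ofFn q.1 ++ List.ofFn q.2 := congrArg List.Vector.toList h
      obtain ⟨h1, h2⟩ := List.append_inj h' (by simp)
      exact Prod.ext (List.ofFn_injective h1) (List.ofFn_injective h2)
    · simp only [Fintype.card_prod, Fintype.card_fun, Fintype.card_bool, Fintype.card_fin, card_vector]
      ring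
  exact (Fintype.sum_bijective φ hφ (fun p => f (List.ofFn p.1 ++ List.ofFn p.2)) (fun w => f w.toList)
    fun p => rfl).symm

/-- The witness length is `2m`. [folklore] -/
theorem length_tf (z : List Bool) : (D.tf z).length = 2 * (D.gas z).length := by
  rw [tf, length_ones, D.length_gas z]

/-- **The first pair count is the uniform exponential sum of `GA`.** [cite: AaronsonChen2017, §5.3 (p. 23, "all the computations can be done in PSPACE")] [cite: AdlemanDeMarraisHuang1997, §6 Lemma 6.10] -/
theorem pcA_eq_sumA : D.pcA = D.sumA := by
  funext z
  have h1 : D.sumA z = ∑ c : Fin (D.gas z).length → Bool, ∑ c' : Fin (D.gas z).length → Bool,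
      D.GA (boolPair z (List.ofFn c ++ List.ofFn c')) :=
    (sum_vector_congr (D.length_tf z) (fun l => D.GA (boolPair z l))).trans
      (sum_vector_eq_sum_pair _ (fun l => D.GA (boolPair z l)))
  rw [h1, pcA, annSetA_eq_sum_consG]
  refine Finset.sum_congr rfl fun c _ => Finset.sum_congr rfl fun c' _ => ?_
  rw [GA_pair]

/-- **The second pair count is the uniform exponential sum of `GB`.** [cite: AaronsonChen2017, §5.3 (p. 23)] [cite: AdlemanDeMarraisHuang1997, §6 Lemma 6.10] -/
theorem pcB_eq_sumB : D.pcB = D.sumB := by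
  funext z
  have h1 : D.sumB z = ∑ c : Fin (D.gas z).length → Bool, ∑ c' : Fin (D.gas z).length → Bool,
      D.GB (boolPair z (List.ofFn c ++ List.ofFn c')) :=
    (sum_vector_congr (D.length_tf z) (fun l => D.GB (boolPair z l))).trans
      (sum_vector_eq_sum_pair _ (fun l => D.GB (boolPair z l)))
  rw [h1, pcB, annSetB_eq_sum_consG]
  refine Finset.sum_congr rfl fun c _ => Finset.sum_congr rfl fun c' _ => ?_
  rw [GB_pair]

/-! ### The hypotheses: uniformity, and polynomial time / space of the readers -/

/-- **The readers are efficient**: the family is uniform, the circuit input and the prefix length are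
read off the instance in polynomial time, membership `s ∈ As z ⟦y⟧` (on strings `⟨z, ⟨y, s⟩⟩`) is a
`PSPACE` predicate, and the label test is polynomial-time. [folklore] -/
structure IsGood (D : PCSpec) : Prop where
  /-- the family is polynomial-time uniform -/
  hU : D.F.IsUniform
  /-- the circuit input is read off the instance in polynomial time -/
  hx : D.xf ∈ FP
  /-- the prefix length (binary) is read off the instance in polynomial time -/
  hn : CodeFP strE natE D.nf
  /-- the annotation languages are uniformly in `PSPACE`: strings `⟨z, ⟨y, s⟩⟩` with `s ∈ As z ⟦y⟧` -/
  hAs : {w : List Bool | sndP (sndP w) ∈ D.As (fstP w) (bitsToNat (fstP (sndP w)))} ∈ PSPACE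
  /-- the label test is polynomial-time on `⟨z, ℓ⟩` -/
  hS : CodeFP (pairE strE strE) bitE (fun p => D.Sb p.1 p.2)

/-! ### Small bridges from the typed `CodeFP` layer -/

/-- A string map computed on the identity codes is in `FP`. [folklore] -/
theorem mem_FP_of_code {f : List Bool → List Bool} (hf : CodeFP strE strE f) : f ∈ FP := by
  obtain ⟨g, hg, hgf⟩ := hf
  have : g = f := funext hgf
  exact this ▸ hg

/-- A Boolean test computed on the identity code decides a `P` language. [cite: AroraBarakCC2009, Def. 1.13] -/
theorem setOf_bit_mem_P {p : List Bool → Bool} (hp : CodeFP strE bitE p) : {w | p w = true} ∈ Classes.P := by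
  obtain ⟨g, hg, hgp⟩ := hp
  refine mem_P_of_mem_FP hg _ fun w => ⟨fun hw => ?_, fun hw => ?_⟩
  · have h := hgp w
    have hw' : p w = true := hw
    rw [hw'] at h
    exact h
  · have h := hgp w
    have hw' : p w = false := by
      cases hpw : p w
      · rfl
      · exact absurd hpw hw
    rw [hw'] at h
    exact h

/-- A string function with one-bit values decides the `P` language of its `1`s. [cite: AroraBarakCC2009, Def. 1.13] -/
theorem setOf_eq_true_mem_P {f : List Bool → List Bool} (hf : CodeFP strE strE f) (hb : ∀ w, ∃ b : Bool, f w = [b]) :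
    {w | f w = [true]} ∈ Classes.P := by
  obtain ⟨g, hg, hgf⟩ := hf
  refine mem_P_of_mem_FP hg _ fun w => ⟨fun hw => ?_, fun hw => ?_⟩
  · have h : g w = f w := hgf w
    rw [h]
    exact hw
  · have h : g w = f w := hgf w
    obtain ⟨b, hb⟩ := hb w
    have hw' : ¬ f w = [true] := hw
    rw [h, hb]
    rw [hb] at hw'
    cases b
    · rfl
    · exact absurd rfl hw'

/-! ### The record argument of the atoms, and the one-bit values of the atoms -/

/-- The record argument of the atoms on `θ = ⟨z, ⟨cs, y⟩⟩`, `t = ⟦y⟧`. [folklore] -/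
def ρθ (θ : List Bool) : List Bool := D.rho (fstP θ) (fstP (sndP θ)) (bitsToNat (sndP (sndP θ)))

/-- The coin atom has one-bit values on every string. [folklore] -/
theorem coinT_eq_singleton (w : List Bool) : ∃ b, coinT D.F w = [b] := by
  refine ⟨headBit (coF (walkO D.F w)), ?_⟩
  rw [show coinT D.F = cT ∘ walkO D.F from rfl, Function.comp_apply, show cT = bitT coF from rfl, bitT_apply]

/-- The oracle-gate atom has one-bit values on the record arguments. [folklore] -/
theorem orcT_ρθ_eq_singleton (θ : List Bool) : ∃ b, orcT D.F (D.ρθ θ) = [b] :=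
  ⟨_, orcT_apply D.F _ _ _⟩

section Codes

variable {D}

/-- `fstP` on codes. [folklore] -/
theorem fstP_code : CodeFP strE strE fstP := of_fn fstP fstP_mem_FP fun _ => rfl

/-- `sndP` on codes. [folklore] -/
theorem sndP_code : CodeFP strE strE sndP := of_fn sndP sndP_mem_FP fun _ => rfl

/-- The circuit input on codes. [folklore] -/
theorem xf_code (hD : D.IsGood) : CodeFP strE strE D.xf := of_fn D.xf hD.hx fun _ => rfl

/-- **The gate codes of the instance's circuit** (uniformity). [cite: AroraBarak2009, §6.2] -/
theorem codes_code (hD : D.IsGood) : CodeFP strE (rawE strE) (fun z => codes D.F (D.xf z)) := by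
  refine of_fn (sndF ∘ sndF ∘ D.F.descFn ∘ D.xf)
    (comp_mem_FP sndF_mem_FP (comp_mem_FP sndF_mem_FP (comp_mem_FP (QCircuitFamily.descFn_mem_FP_of_isUniform hD.hU) hD.hx)))
    fun z => ?_
  simp only [Function.comp_apply, descFn_eq, sndF_boolPair, rawE, strE, List.map_id]
  rfl

/-- The number of gates, unary. [folklore] -/
theorem μ_code (hD : D.IsGood) : CodeFP strE unE D.μ :=
  ((ulength strE).comp (codes_code hD)).congr fun z => by simp [μ, codes]

/-- The prefix length `m = min n μ`, unary. [folklore] -/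
theorem m_code (hD : D.IsGood) : CodeFP strE unE D.m :=
  (unOfNatMin.comp ((μ_code hD).pair hD.hn)).congr fun z => by simp [m, Nat.min_comm]

/-- The witness length `1^{2m}`. [folklore] -/
theorem tf_code (hD : D.IsGood) : CodeFP strE strE D.tf :=
  (strOfUn.comp (unAdd.comp ((m_code hD).pair (m_code hD)))).congr fun z => by
    simp only [tf, unE_eq_ones, two_mul]

/-- The walk record argument on codes, from its three readers. [folklore] -/
theorem rho_code (hD : D.IsGood) {Z C : List Bool → List Bool} {T : List Bool → ℕ} (hZ : CodeFP strE strE Z)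
    (hC : CodeFP strE strE C) (hT : CodeFP strE natE T) : CodeFP strE strE (fun q => D.rho (Z q) (C q) (T q)) :=
  (((xf_code hD).comp hZ).pair (hC.pair hT)).recodeOut fun _ => rfl

/-- The first coin string on codes. [folklore] -/
theorem c₁_code (hD : D.IsGood) : CodeFP strE strE D.c₁ :=
  (strTake.comp (((m_code hD).comp fstP_code).pair sndP_code)).congr fun _ => rfl

/-- The second coin string on codes. [folklore] -/
theorem c₂_code (hD : D.IsGood) : CodeFP strE strE D.c₂ :=
  (strDrop.comp (((m_code hD).comp fstP_code).pair sndP_code)).congr fun _ => rfl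

/-- The first walk record argument on codes. [folklore] -/
theorem ρ₁_code (hD : D.IsGood) : CodeFP strE strE D.ρ₁ := rho_code hD fstP_code (c₁_code hD) (hD.hn.comp fstP_code)

/-- The second walk record argument on codes. [folklore] -/
theorem ρ₂_code (hD : D.IsGood) : CodeFP strE strE D.ρ₂ := rho_code hD fstP_code (c₂_code hD) (hD.hn.comp fstP_code)

/-- The counted walk on codes. [cite: AroraBarak2009, §1.3, §6.2] -/
theorem walkO_code (hD : D.IsGood) : CodeFP strE strE (walkO D.F) := of_fn _ (walkO_mem_FP D.F hD.hU) fun _ => rfl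

/-- Equality of two computed strings, as a computed bit (generic, so that no projection meets a machine
term when matching). [folklore] -/
theorem eqStr_code {f g : List Bool → List Bool} (hf : CodeFP strE strE f) (hg : CodeFP strE strE g) :
    CodeFP strE bitE (fun a => decide (f a = g a)) :=
  ((CodeFP.eq (eα := strE) (fun _ _ h => h)).comp (hf.pair hg)).congr fun _ => rfl

/-- The test "the computed string is `[1]`". [folklore] -/
theorem eqTrue_code {f : List Bool → List Bool} (hf : CodeFP strE strE f) : CodeFP strE bitE (fun a => decide (f a = [true])) :=
  eqStr_code hf (CodeFP.const strE [true])

/-- The label test on two computed strings. [folklore] -/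
theorem Sb_code (hD : D.IsGood) {Z L : List Bool → List Bool} (hZ : CodeFP strE strE Z) (hL : CodeFP strE strE L) :
    CodeFP strE bitE (fun a => D.Sb (Z a) (L a)) :=
  (hD.hS.comp (hZ.pair hL)).congr fun _ => rfl

/-- The phase class `(n₁ + 7 n₂) mod 8` of two computed numbers. [folklore] -/
theorem cls_code {n₁ n₂ : List Bool → ℕ} (h₁ : CodeFP strE natE n₁) (h₂ : CodeFP strE natE n₂) :
    CodeFP strE natE (fun a => (n₁ a + 7 * n₂ a) % 8) :=
  (natMod.comp ((natAdd.comp (h₁.pair (natMul.comp ((CodeFP.const strE 7).pair h₂)))).pair (CodeFP.const strE 8))).congr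
    fun _ => rfl

/-- The test "the computed number is `d`". [folklore] -/
theorem natEqConst_code {n : List Bool → ℕ} (h : CodeFP strE natE n) (d : ℕ) : CodeFP strE bitE (fun a => decide (n a = d)) :=
  (natEq.comp (h.pair (CodeFP.const strE d))).congr fun _ => rfl

/-- The length of a computed string, binary. [folklore] -/
theorem lengthNat_code {f : List Bool → List Bool} (hf : CodeFP strE strE f) : CodeFP strE natE (fun a => (f a).length) :=
  (strNatLength.comp hf).congr fun _ => rfl

/-- The conjunction of two computed bits. [folklore] -/
theorem and_code {p q : List Bool → Bool} (hp : CodeFP strE bitE p) (hq : CodeFP strE bitE q) :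
    CodeFP strE bitE (fun a => p a && q a) :=
  hp.and hq

/-- **The final-state test is polynomial-time.** [cite: AdlemanDeMarraisHuang1997, §6 Lemma 6.10] [cite: AroraBarak2009, §1.3] -/
theorem finB_code (hD : D.IsGood) (d : ℕ) : CodeFP strE bitE (D.finB d) := by
  have hw : CodeFP strE strE (walkO D.F) := walkO_code hD
  have hv : CodeFP strE strE vT := of_fn vT vT_mem_FP fun _ => rfl
  have hl : CodeFP strE strE wF := of_fn (nthF 3) (nthF_mem_FP 3) fun _ => rfl
  have hph : CodeFP strE strE phF := of_fn (nthF 4) (nthF_mem_FP 4) fun _ => rfl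
  have hW₁ : CodeFP strE strE (fun q => walkO D.F (D.ρ₁ q)) := hw.comp (ρ₁_code hD)
  have hW₂ : CodeFP strE strE (fun q => walkO D.F (D.ρ₂ q)) := hw.comp (ρ₂_code hD)
  have hv₁ : CodeFP strE strE (fun q => vT (walkO D.F (D.ρ₁ q))) := hv.comp hW₁
  have hv₂ : CodeFP strE strE (fun q => vT (walkO D.F (D.ρ₂ q))) := hv.comp hW₂
  have hl₁ : CodeFP strE strE (fun q => wF (walkO D.F (D.ρ₁ q))) := hl.comp hW₁
  have hl₂ : CodeFP strE strE (fun q => wF (walkO D.F (D.ρ₂ q))) := hl.comp hW₂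
  have hp₁ : CodeFP strE strE (fun q => phF (walkO D.F (D.ρ₁ q))) := hph.comp hW₁
  have hp₂ : CodeFP strE strE (fun q => phF (walkO D.F (D.ρ₂ q))) := hph.comp hW₂
  have b1 : CodeFP strE bitE (fun q => decide (vT (walkO D.F (D.ρ₁ q)) = [true])) := eqTrue_code hv₁
  have b2 : CodeFP strE bitE (fun q => decide (vT (walkO D.F (D.ρ₂ q)) = [true])) := eqTrue_code hv₂
  have b3 : CodeFP strE bitE (fun q => decide (wF (walkO D.F (D.ρ₁ q)) = wF (walkO D.F (D.ρ₂ q)))) := eqStr_code hl₁ hl₂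
  have b4 : CodeFP strE bitE (fun q => D.Sb (fstP q) (wF (walkO D.F (D.ρ₁ q)))) := Sb_code hD fstP_code hl₁
  have hcls : CodeFP strE natE (fun q => ((phF (walkO D.F (D.ρ₁ q))).length + 7 * (phF (walkO D.F (D.ρ₂ q))).length) % 8) :=
    cls_code (lengthNat_code hp₁) (lengthNat_code hp₂)
  have b5 : CodeFP strE bitE (fun q =>
      decide (((phF (walkO D.F (D.ρ₁ q))).length + 7 * (phF (walkO D.F (D.ρ₂ q))).length) % 8 = d)) :=
    natEqConst_code hcls d
  exact and_code b1 (and_code b2 (and_code b3 (and_code b4 b5)))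

/-! ### The relations are in `PSPACE` -/

/-- Pairing two computed strings (generic: matching against machine terms is by instantiation only).
[folklore] -/
theorem pair2_code {A B : List Bool → List Bool} (hA : CodeFP strE strE A) (hB : CodeFP strE strE B) :
    CodeFP strE strE (fun a => boolPair (A a) (B a)) :=
  (hA.pair hB).recodeOut fun _ => rfl

/-- The record of three computed strings. [folklore] -/
theorem pair3_code {A B C : List Bool → List Bool} (hA : CodeFP strE strE A) (hB : CodeFP strE strE B)
    (hC : CodeFP strE strE C) : CodeFP strE strE (fun a => boolPair (A a) (boolPair (B a) (C a))) :=
  (hA.pair (hB.pair hC)).recodeOut fun _ => rfl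

/-- The record argument on codes. [folklore] -/
theorem ρθ_code (hD : D.IsGood) : CodeFP strE strE D.ρθ :=
  (rho_code hD fstP_code (fstP_code.comp sndP_code) (strVal.comp (sndP_code.comp sndP_code))).congr fun _ => rfl

/-- **The consistency condition is a `PSPACE` predicate** (the atoms are polynomial-time; the answer of
the gate's language is a `PSPACE` query). [cite: AaronsonChen2017, §5.3 (p. 23, "all the computations can be done in PSPACE")] -/
theorem CAt_mem_PSPACE (hD : D.IsGood) : D.CAt ∈ PSPACE := by
  obtain ⟨B, hB⟩ := exists_isComplete_PSPACE_holds
  obtain ⟨-, -, -, -, -, horc, -, hcoin, hqry, -⟩ := atoms_mem_FP (F := D.F) hD.hU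
  have horc' : CodeFP strE strE (orcT D.F) := of_fn (orcT D.F) horc fun _ => rfl
  have hcoin' : CodeFP strE strE (coinT D.F) := of_fn (coinT D.F) hcoin fun _ => rfl
  have hqry' : CodeFP strE strE (qryF D.F) := of_fn (qryF D.F) hqry fun _ => rfl
  have c1 : CodeFP strE strE (fun θ => orcT D.F (D.ρθ θ)) := horc'.comp (ρθ_code hD)
  have c2 : CodeFP strE strE (fun θ => coinT D.F (D.ρθ θ)) := hcoin'.comp (ρθ_code hD)
  have c3 : CodeFP strE strE (fun θ => boolPair (fstP θ) (boolPair (sndP (sndP θ)) (qryF D.F (D.ρθ θ)))) :=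
    pair3_code fstP_code (sndP_code.comp sndP_code) (hqry'.comp (ρθ_code hD))
  have h1 : {θ | orcT D.F (D.ρθ θ) = [true]} ∈ PSPACE :=
    P_subset_PSPACE_holds (setOf_eq_true_mem_P c1 D.orcT_ρθ_eq_singleton)
  have h2 : {θ | coinT D.F (D.ρθ θ) = [true]} ∈ PSPACE :=
    P_subset_PSPACE_holds (setOf_eq_true_mem_P c2 fun θ => D.coinT_eq_singleton _)
  have h3 : {θ | qryF D.F (D.ρθ θ) ∈ D.As (fstP θ) (bitsToNat (sndP (sndP θ)))} ∈ PSPACE := by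
    refine mem_PSPACE_of_iff' (preimage_mem_PSPACE hD.hAs (mem_FP_of_code c3)) _ fun θ => ?_
    rw [memL_preimage]
    show _ ↔ sndP (sndP (boolPair (fstP θ) (boolPair (sndP (sndP θ)) (qryF D.F (D.ρθ θ))))) ∈
      D.As (fstP (boolPair (fstP θ) (boolPair (sndP (sndP θ)) (qryF D.F (D.ρθ θ)))))
        (bitsToNat (fstP (sndP (boolPair (fstP θ) (boolPair (sndP (sndP θ)) (qryF D.F (D.ρθ θ)))))))
    simp only [fstP_boolPair, sndP_boolPair]
    exact Iff.rfl
  have h23 : {θ | coinT D.F (D.ρθ θ) = [true] ↔ qryF D.F (D.ρθ θ) ∈ D.As (fstP θ) (bitsToNat (sndP (sndP θ)))} ∈ PSPACE := by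
    refine mem_PSPACE_of_iff' (setOf_or_mem_PSPACE_of_complete hB (setOf_and_mem_PSPACE_of_complete hB h2 h3)
      (setOf_and_mem_PSPACE_of_complete hB (compl_mem_PSPACE h2) (compl_mem_PSPACE h3))) _ fun θ => ?_
    show _ ↔ (coinT D.F (D.ρθ θ) = [true] ∧ qryF D.F (D.ρθ θ) ∈ D.As (fstP θ) (bitsToNat (sndP (sndP θ)))) ∨
      (¬ coinT D.F (D.ρθ θ) = [true] ∧ ¬ qryF D.F (D.ρθ θ) ∈ D.As (fstP θ) (bitsToNat (sndP (sndP θ))))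
    exact iff_iff_and_or_not_and_not
  exact mem_PSPACE_of_iff' (setOf_imp_mem_PSPACE_of_complete hB h1 h23) _ fun θ => Iff.rfl

/-- The body of the bounded quantifier is a `PSPACE` predicate. [folklore] -/
theorem CAllBody_mem_PSPACE (hD : D.IsGood) : D.CAllBody ∈ PSPACE := by
  obtain ⟨B, hB⟩ := exists_isComplete_PSPACE_holds
  have ht : CodeFP strE natE (fun q => bitsToNat (sndP q)) := strVal.comp sndP_code
  have hn : CodeFP strE natE (fun q => D.nf (fstP (fstP q))) := hD.hn.comp (fstP_code.comp fstP_code)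
  have hl : CodeFP strE natE (fun q => (sndP (fstP q)).length) := lengthNat_code (sndP_code.comp fstP_code)
  have t1 : CodeFP strE bitE (fun q => decide (bitsToNat (sndP q) < D.nf (fstP (fstP q)))) :=
    (natLt.comp (ht.pair hn)).congr fun _ => rfl
  have t2 : CodeFP strE bitE (fun q => decide (bitsToNat (sndP q) < (sndP (fstP q)).length)) :=
    (natLt.comp (ht.pair hl)).congr fun _ => rfl
  have h1 : {q | bitsToNat (sndP q) < D.nf (fstP (fstP q))} ∈ PSPACE := by
    refine P_subset_PSPACE_holds (mem_P_of_iff (setOf_bit_mem_P t1) _ fun q => ?_)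
    show _ ↔ decide _ = true
    rw [decide_eq_true_iff]
    exact Iff.rfl
  have h2 : {q | bitsToNat (sndP q) < (sndP (fstP q)).length} ∈ PSPACE := by
    refine P_subset_PSPACE_holds (mem_P_of_iff (setOf_bit_mem_P t2) _ fun q => ?_)
    show _ ↔ decide _ = true
    rw [decide_eq_true_iff]
    exact Iff.rfl
  have hg : CodeFP strE strE (fun q => boolPair (fstP (fstP q)) (boolPair (sndP (fstP q)) (sndP q))) :=
    pair3_code (fstP_code.comp fstP_code) (sndP_code.comp fstP_code) sndP_code
  have h3 : {q | boolPair (fstP (fstP q)) (boolPair (sndP (fstP q)) (sndP q)) ∈ D.CAt} ∈ PSPACE :=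
    mem_PSPACE_of_iff' (preimage_mem_PSPACE (CAt_mem_PSPACE hD) (mem_FP_of_code hg)) _ fun _ => Iff.rfl
  exact mem_PSPACE_of_iff' (setOf_imp_mem_PSPACE_of_complete hB h1 (setOf_imp_mem_PSPACE_of_complete hB h2 h3)) _
    fun q => Iff.rfl

/-- **Consistency of all the guesses is a `PSPACE` predicate** (a polynomially bounded `∀`).
[cite: AaronsonChen2017, §5.3 (p. 23)] [cite: AroraBarakCC2009, Thm. 4.2 and §4.1] -/
theorem CAll_mem_PSPACE (hD : D.IsGood) : D.CAll ∈ PSPACE := polyForall_mem_PSPACE (CAllBody_mem_PSPACE hD) X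

/-- **The counted relations are `PSPACE` predicates.** [cite: AaronsonChen2017, §5.3 (p. 23)] -/
theorem R_mem_PSPACE (hD : D.IsGood) (d : ℕ) : D.R d ∈ PSPACE := by
  obtain ⟨B, hB⟩ := exists_isComplete_PSPACE_holds
  have g1 : CodeFP strE strE (fun q => boolPair (fstP q) (D.c₁ q)) := pair2_code fstP_code (c₁_code hD)
  have g2 : CodeFP strE strE (fun q => boolPair (fstP q) (D.c₂ q)) := pair2_code fstP_code (c₂_code hD)
  have h1 : {q | boolPair (fstP q) (D.c₁ q) ∈ D.CAll} ∈ PSPACE :=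
    mem_PSPACE_of_iff' (preimage_mem_PSPACE (CAll_mem_PSPACE hD) (mem_FP_of_code g1)) _ fun _ => Iff.rfl
  have h2 : {q | boolPair (fstP q) (D.c₂ q) ∈ D.CAll} ∈ PSPACE :=
    mem_PSPACE_of_iff' (preimage_mem_PSPACE (CAll_mem_PSPACE hD) (mem_FP_of_code g2)) _ fun _ => Iff.rfl
  have h3 : {q | D.finB d q = true} ∈ PSPACE := P_subset_PSPACE_holds (setOf_bit_mem_P (finB_code hD d))
  exact mem_PSPACE_of_iff' (setOf_and_mem_PSPACE_of_complete hB h1 (setOf_and_mem_PSPACE_of_complete hB h2 h3)) _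
    fun q => Iff.rfl

/-! ### The pair counts are `GapNatPSPACE` functions -/

/-- The signed summand of `A_S` is a `GapNatPSPACE` function. [cite: FennerFortnowKurtz1994, §3] -/
theorem GA_mem_GapNatPSPACE (hD : D.IsGood) : D.GA ∈ GapNatPSPACE :=
  sub_mem_GapNatPSPACE (ite_mem_GapNatPSPACE (const_mem_GapNatPSPACE 1) (R_mem_PSPACE hD 0))
    (ite_mem_GapNatPSPACE (const_mem_GapNatPSPACE 1) (R_mem_PSPACE hD 4))

/-- The signed summand of `B_S` is a `GapNatPSPACE` function. [cite: FennerFortnowKurtz1994, §3] -/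
theorem GB_mem_GapNatPSPACE (hD : D.IsGood) : D.GB ∈ GapNatPSPACE :=
  sub_mem_GapNatPSPACE (sub_mem_GapNatPSPACE (add_mem_GapNatPSPACE
    (ite_mem_GapNatPSPACE (const_mem_GapNatPSPACE 1) (R_mem_PSPACE hD 1))
    (ite_mem_GapNatPSPACE (const_mem_GapNatPSPACE 1) (R_mem_PSPACE hD 7)))
    (ite_mem_GapNatPSPACE (const_mem_GapNatPSPACE 1) (R_mem_PSPACE hD 3)))
    (ite_mem_GapNatPSPACE (const_mem_GapNatPSPACE 1) (R_mem_PSPACE hD 5))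

/-- **The first pair count `A_S` of the annotated prefixes is a `GapNatPSPACE` function of the
instance.** [cite: AaronsonChen2017, §5.3 (p. 23, "all the computations can be done in PSPACE")] [cite: FennerFortnowKurtz1994, §3 (closure under uniform sums)] [cite: AdlemanDeMarraisHuang1997, §6 Lemma 6.10] -/
theorem pcA_mem_GapNatPSPACE (hD : D.IsGood) : D.pcA ∈ GapNatPSPACE := by
  rw [pcA_eq_sumA]
  exact sum_mem_GapNatPSPACE (GA_mem_GapNatPSPACE hD) (mem_FP_of_code (tf_code hD))

/-- **The second pair count `B_S` of the annotated prefixes is a `GapNatPSPACE` function of the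
instance.** [cite: AaronsonChen2017, §5.3 (p. 23)] [cite: FennerFortnowKurtz1994, §3] [cite: AdlemanDeMarraisHuang1997, §6 Lemma 6.10] -/
theorem pcB_mem_GapNatPSPACE (hD : D.IsGood) : D.pcB ∈ GapNatPSPACE := by
  rw [pcB_eq_sumB]
  exact sum_mem_GapNatPSPACE (GB_mem_GapNatPSPACE hD) (mem_FP_of_code (tf_code hD))

end Codes

end PCSpec

end ADH

end Literature.Computability.QuantumComplexity

end
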